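import Literature.NumberTheory.Transcendental.ExtrapolationScaled
import HarnessLib

/-!
# The extrapolation estimate with zeros at spaced multiples (torsion case of Baker's method)

Topic: `Literature/NumberTheory/Transcendental`. Plan item W4 (closing, torsion case, part 3)
of the unit `provefact-Literature.NumberTheory.Transcendental.H-b596640137`. In the torsion
case (Baker–Wüstholz, *Logarithmic Forms and Diophantine Geometry*, §6.8, pp. 117–119) the
extrapolation function `φ_{x,k}(z) = ∂_ξ^k F_P(z·v + ξx)|₀` of the division point `v = u/ℓ` has
zeros of order `≥ T - k` at the SPACED points `z = ℓ j`, `j = 0, …, S₀` (these are the multiples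
`s·u` of the original point; in the source: "the function `ψ(w) = Ψ(ℓw)` has a zero at each
`s = 0, …, S` with order at least `[T/2] + 1`"), and it is evaluated at all integers `s ≤ S₁`.
PROVED: `BakerData.norm_extrapFun_grid_le₃` — for `v ∈ 𝔟`, vanishing to order `≥ T` along `𝔟` at
`(ℓ j)·v`, `j ≤ S₀`, `c_m ≤ k`, `R ≥ 2(s + ℓS₀)`, `R > 0`:
`|φ_{x_c,k}(s)| ≤ k!·(kX+1)^k·#U·H_ξ·e^{C(1+(R‖v‖+1)²)·D}·(2(s+ℓS₀)/R)^{(T-k)(S₀+1)}`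
(the scaled Cauchy radius of `ExtrapolationScaled.lean`, the Schwarz lemma with multiplicities
`Baker1975.Analytic.norm_le_of_analyticOrderAt` at the finite set `{ℓ j : j ≤ S₀}`).

## References

* A. Baker, G. Wüstholz, *Logarithmic Forms and Diophantine Geometry*, CUP 2007, §6.8 (p. 119).
* A. Baker, *Transcendental Number Theory*, CUP 1975, Ch. 2, Lemmas 4–5.
-/

noncomputable section

open Complex Metric Set MvPolynomial Finset NumberField
open scoped PeriodPair

namespace Literature.NumberTheory.Transcendental

namespace GaGmE

namespace Std

namespace BakerData

variable {β γ δ : Type} [Fintype β] [Fintype γ] [Fintype δ] [DecidableEq γ]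
variable [DecidableEq β] [DecidableEq δ] (B : BakerData β γ δ)

/-- **The extrapolation estimate with zeros at the spaced multiples `(ℓ j)·v`, `j ≤ S₀`** (scaled
Cauchy radius `r = 1/(kX + 1)`): for `v ∈ 𝔟`, vanishing to order `≥ T` along `𝔟` at `(ℓ j)·v`,
`j ≤ S₀`, `c_m ≤ k`, `R ≥ 2(s + ℓS₀)`, `R > 0`:
`|φ_{x_c,k}(s)| ≤ k!·(kX+1)^k·#U·H_ξ·e^{C(1+(R‖v‖+1)²)·D}·(2(s+ℓS₀)/R)^{(T-k)(S₀+1)}`.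
[cite: BakerWustholz2007, §6.8 (p. 119: ψ(w) = Ψ(ℓw), Schwarz with r' = S, r = S²)] -/
theorem norm_extrapFun_grid_le₃ {C : ℝ} (hC0 : 0 ≤ C)
    (hC : ∀ (J : Option β × ThetaIdx γ δ) (w : β ⊕ (γ ⊕ δ) → ℂ),
      ‖theta B.L B.κM J w‖ ≤ Real.exp (C * (1 + ‖w‖ ^ 2)))
    (hv : B.v ∈ B.bSpan) {D' : ℕ} (ξ : UIdx β γ δ D' → 𝓞 B.K) {ℓ T S₀ : ℕ} (hℓ : 0 < ℓ)
    (hvan : ∀ j : ℕ, j ≤ S₀ →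
      VanishesAlong B.bSpan (thetaEval B.L B.κM (B.auxForm ξ)) (((ℓ * j : ℕ) : ℂ) • B.v) T)
    {k : ℕ} {cg : Fin B.dd → ℕ} (hcg : ∀ m, cg m ≤ k) (s : ℕ) {R : ℝ} (hR0 : 0 < R)
    (hR : 2 * ((s : ℝ) + ℓ * S₀) ≤ R) :
    ‖extrapFun B.L B.κM (B.auxForm ξ) B.v (B.gridDir cg) k s‖ ≤
      k.factorial * ((k : ℝ) * B.dirNorm + 1) ^ k * (Fintype.card (UIdx β γ δ D') * B.houseXi ξ *
        Real.exp (C * (1 + (R * ‖B.v‖ + 1) ^ 2)) ^ (Fintype.card (β ⊕ (γ ⊕ δ)) * D')) *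
        (2 * ((s : ℝ) + ℓ * S₀) / R) ^ ((T - k) * (S₀ + 1)) := by
  set D := Fintype.card (β ⊕ (γ ⊕ δ)) * D' with hD
  set f := extrapFun B.L B.κM (B.auxForm ξ) B.v (B.gridDir cg) k with hf
  set r : ℝ := 1 / ((k : ℝ) * B.dirNorm + 1) with hr
  have hX0 := B.dirNorm_nonneg
  have hr0 : 0 < r := by rw [hr]; positivity
  have hrx : r * ‖B.gridDir cg‖ ≤ 1 := by
    have hX := B.norm_gridDir_le hcg
    rw [hr, one_div, inv_mul_le_iff₀ (by positivity)]
    linarith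
  -- the spaced points `ℓ j`, `j ≤ S₀`
  set pts : Finset ℂ := (Finset.range (S₀ + 1)).image (fun j : ℕ => ((ℓ * j : ℕ) : ℂ)) with hpts
  have hinj : Function.Injective (fun j : ℕ => ((ℓ * j : ℕ) : ℂ)) := by
    intro j j' hjj'
    have hjj'' : ((ℓ * j : ℕ) : ℂ) = ((ℓ * j' : ℕ) : ℂ) := hjj'
    have : ℓ * j = ℓ * j' := by exact_mod_cast hjj''
    exact Nat.eq_of_mul_eq_mul_left hℓ this
  have hcard : pts.card = S₀ + 1 := by
    rw [hpts, Finset.card_image_of_injective _ hinj, Finset.card_range]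
  have hℓS0 : (0 : ℝ) ≤ (ℓ : ℝ) * S₀ := by positivity
  have hptnorm : ∀ c ∈ pts, ‖c‖ ≤ (ℓ : ℝ) * S₀ := by
    intro c hc
    obtain ⟨j, hj, rfl⟩ := Finset.mem_image.mp hc
    have hjS : (j : ℝ) ≤ S₀ := by exact_mod_cast Nat.lt_succ_iff.mp (Finset.mem_range.mp hj)
    rw [Complex.norm_natCast]; push_cast
    exact mul_le_mul_of_nonneg_left hjS (Nat.cast_nonneg ℓ)
  have hdiff : Differentiable ℂ f := differentiable_extrapFun B.L B.κM _ _ _ k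
  have hord : ∀ c ∈ pts, ((T - k : ℕ) : ℕ∞) ≤ analyticOrderAt f c := by
    intro c hc
    obtain ⟨j, hj, rfl⟩ := Finset.mem_image.mp hc
    have hjS : j ≤ S₀ := Nat.lt_succ_iff.mp (Finset.mem_range.mp hj)
    exact le_analyticOrderAt_extrapFun B.L B.κM _ hv (B.gridDir_mem cg) (hvan j hjS) k
  -- the bound on the circle `|z| = R` with Cauchy radius `r` in `ξ`
  set θ : ℝ := k.factorial * (Nesterenko.l1Norm (B.auxForm ξ) *
    Real.exp (C * (1 + (R * ‖B.v‖ + 1) ^ 2)) ^ D) / r ^ k with hθ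
  have hθb : ∀ z ∈ sphere (0 : ℂ) R, ‖f z‖ ≤ θ := by
    intro z hz
    have hzR : ‖z‖ = R := by simpa using hz
    have h := norm_extrapFun_le_radius B.L B.κM hC0 hC (P := B.auxForm ξ) (D := D)
      ((isHomogeneous_homog D (B.QOf ξ)).totalDegree_le) B.v (B.gridDir cg) k z hr0
    rw [hzR] at h
    refine h.trans ?_
    rw [hθ]
    refine div_le_div_of_nonneg_right (mul_le_mul_of_nonneg_left (mul_le_mul_of_nonneg_left
      (pow_le_pow_left₀ (Real.exp_nonneg _) (Real.exp_le_exp.mpr (mul_le_mul_of_nonneg_left ?_ hC0)) D)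
      (Nesterenko.l1Norm_nonneg _)) (Nat.cast_nonneg _)) (pow_nonneg hr0.le _)
    have h1 : 0 ≤ R * ‖B.v‖ + r * ‖B.gridDir cg‖ := by positivity
    nlinarith
  -- separation on the circle: `|z - ℓj| ≥ R - ℓS₀ ≥ R/2`
  have hsep : ∀ z ∈ sphere (0 : ℂ) R, ∀ c ∈ pts, R / 2 ≤ ‖z - c‖ := by
    intro z hz c hc
    have hzR : ‖z‖ = R := by simpa using hz
    have hc' := hptnorm c hc
    have h1 : ‖z‖ - ‖c‖ ≤ ‖z - c‖ := norm_sub_norm_le z c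
    rw [hzR] at h1
    have hs0 : (0 : ℝ) ≤ s := Nat.cast_nonneg s
    linarith
  have hm : (0 : ℝ) < (R / 2) ^ ((T - k) * pts.card) := pow_pos (by linarith) _
  have hmF : ∀ z ∈ sphere (0 : ℂ) R, (R / 2) ^ ((T - k) * pts.card) ≤ ‖∏ c ∈ pts, (z - c) ^ (T - k)‖ :=
    fun z hz => Baker1975.Analytic.le_norm_prod_pow pts (T - k) (by linarith) (hsep z hz)
  have hsR : ‖(s : ℂ)‖ ≤ R := by
    rw [Complex.norm_natCast]
    have hs0 : (0 : ℝ) ≤ s := Nat.cast_nonneg s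
    linarith
  have hmain := Baker1975.Analytic.norm_le_of_analyticOrderAt hdiff pts (T - k) hord hR0 hθb hm hmF hsR
  have hup : ‖∏ c ∈ pts, ((s : ℂ) - c) ^ (T - k)‖ ≤ ((s : ℝ) + ℓ * S₀) ^ ((T - k) * pts.card) := by
    refine Baker1975.Analytic.norm_prod_pow_le pts (T - k) fun c hc => ?_
    have hc' := hptnorm c hc
    calc ‖(s : ℂ) - c‖ ≤ ‖(s : ℂ)‖ + ‖c‖ := norm_sub_le _ _
      _ = s + ‖c‖ := by rw [Complex.norm_natCast]
      _ ≤ s + ℓ * S₀ := by linarith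
  rw [hcard] at hm hup hmain
  have hθ0 : 0 ≤ θ := by
    rw [hθ]; have := Nesterenko.l1Norm_nonneg (B.auxForm ξ); positivity
  have step1 : ‖f s‖ ≤ θ * (2 * ((s : ℝ) + ℓ * S₀) / R) ^ ((T - k) * (S₀ + 1)) := by
    refine hmain.trans ?_
    have e : θ / (R / 2) ^ ((T - k) * (S₀ + 1)) * ((s : ℝ) + ℓ * S₀) ^ ((T - k) * (S₀ + 1)) =
        θ * (2 * ((s : ℝ) + ℓ * S₀) / R) ^ ((T - k) * (S₀ + 1)) := by
      rw [show 2 * ((s : ℝ) + ℓ * S₀) / R = (2 / R) * ((s : ℝ) + ℓ * S₀) from by ring, mul_pow, div_pow, div_pow]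
      field_simp
    rw [← e]
    exact mul_le_mul_of_nonneg_left hup (div_nonneg hθ0 hm.le)
  refine step1.trans (mul_le_mul_of_nonneg_right ?_ (by positivity))
  -- `θ ≤ k!·(kX+1)^k·#U·H_ξ·e^{…}`
  rw [hθ, hr, one_div, inv_pow, div_eq_mul_inv, inv_inv]
  have hcoeff := (B.l1Norm_homog_QOf_le ξ).trans (B.sum_norm_xi_le ξ)
  have hHξ := B.one_le_houseXi ξ
  have hE0 : 0 ≤ Real.exp (C * (1 + (R * ‖B.v‖ + 1) ^ 2)) ^ D := pow_nonneg (Real.exp_nonneg _) _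
  have hkX : 0 ≤ ((k : ℝ) * B.dirNorm + 1) ^ k := by positivity
  calc (k.factorial : ℝ) * (Nesterenko.l1Norm (B.auxForm ξ) * Real.exp (C * (1 + (R * ‖B.v‖ + 1) ^ 2)) ^ D) *
        ((k : ℝ) * B.dirNorm + 1) ^ k
      ≤ (k.factorial : ℝ) * ((Fintype.card (UIdx β γ δ D') * B.houseXi ξ) *
          Real.exp (C * (1 + (R * ‖B.v‖ + 1) ^ 2)) ^ D) * ((k : ℝ) * B.dirNorm + 1) ^ k := by
        refine mul_le_mul_of_nonneg_right (mul_le_mul_of_nonneg_left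
          (mul_le_mul_of_nonneg_right hcoeff hE0) (Nat.cast_nonneg _)) hkX
    _ = _ := by ring

end BakerData

end Std

end GaGmE

end Literature.NumberTheory.Transcendental

end
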